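import Literature.Probability.LatticeModels.TriMeshLattice
import Literature.Probability.LatticeModels.TriangularLatticeProofs
import HarnessLib

/-!
# The honeycomb lattice inside the fine triangular lattice: coordinates

Topic: Probability / LatticeModels (first file of the honeycomb twin `HexMesh*` of the series
"the largest mesh component of a Jordan domain is the bulk", `MeshDomainJordan.lean` /
`TriMeshTriJordan.lean`; sub-namespace `Literature.Probability.LatticeModels.HexMesh`).

The vertices of the honeycomb lattice `hexGraph` (the faces `(x, t)` of `𝕋`, embedded by
`hexCenter`) together with the hexagon centres (the sites of `𝕋`) form the *fine* triangular
lattice `𝕋'' = R · 𝕋`, `R = (1 + ζ)/3` (rotation by `π/6`, scaling by `1/√3`). In the lattice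
coordinates of `𝕋''` the face `(x, t)` is the site

  `φ(x, t) = (2x₀ + x₁ + t + 1, x₁ - x₀)`,

the hexagon centres are the sites `s` with `3 ∣ s₀ - s₁` (we call them *centre sites*; the sites
`φ(x, t)` have `s₀ - s₁ ≡ t + 1`), and honeycomb adjacency is `𝕋`-adjacency of the sites. This
file proves this dictionary: `hexCenter (x,t) = R · triEmbed (φ(x,t))`, `φ` is injective with
image the non-centre sites, `hexGraph`-adjacency ↔ `triGraph`-adjacency of the images, and two
centre sites are never `𝕋`-adjacent. No definitions: the attachment `φ` enters every statement as
an arbitrary function together with the hypothesis `hφ` that it is given by the displayed formula.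

Folklore lattice geometry (Grimmett 1999, §1.6, Fig. 1.7: duality of the triangular and hexagonal
lattices). Mathlib anchors: `Matrix.cons_val_zero`, `Matrix.cons_val_one`. H21 anchors:
`hexCenter`, `triEmbed`, `triZeta_sq`, `hexGraph_adj_iff_of_snd_eq_zero_holds`,
`hexGraph_adj_iff_of_snd_eq_one`, `not_hexGraph_adj_of_snd_eq_holds`, `Mesh.triGraph_adj_iff_coord'`,
`Mesh.site2_ext'`, `triMeshPoint`.
-/

namespace Literature.Probability.LatticeModels.HexMesh

open Complex Literature.Probability.LatticeModels

/-! ### Facts not involving the attachment -/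

/-- A face of `𝕋` is an up face `(x, 0)` or a down face `(x, 1)`. [folklore] -/
theorem hexVertex_eq_up_or_down (v : HexVertex) : v = (v.1, 0) ∨ v = (v.1, 1) := by
  obtain ⟨x, ⟨_ | _ | n, hn⟩⟩ := v
  · exact Or.inl rfl
  · exact Or.inr rfl
  · omega

/-- The factor `R = (1 + ζ)/3` is nonzero. [folklore] -/
theorem one_add_triZeta_div_three_ne_zero : (1 + triZeta) / 3 ≠ (0 : ℂ) := by
  intro h
  have := congrArg Complex.im h
  simp at this

/-- `‖(1 + ζ)/3‖² = 1/3` (the fine lattice has mesh `1/√3`). [folklore] -/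
theorem norm_one_add_triZeta_div_three_sq : ‖(1 + triZeta) / 3‖ ^ 2 = 1 / 3 := by
  have h3 : Real.sqrt 3 * Real.sqrt 3 = 3 := Real.mul_self_sqrt (by norm_num)
  have hn : Complex.normSq (1 + triZeta) = 3 := by
    rw [Complex.normSq_apply]
    simp only [add_re, one_re, triZeta_re, add_im, one_im, triZeta_im]
    nlinarith [h3]
  rw [norm_div, div_pow, ← Complex.normSq_eq_norm_sq, hn]
  norm_num

/-- **Centre sites are never `𝕋`-adjacent** (and more: along a `𝕋`-edge the residue of `s₀ - s₁`
changes). [folklore] -/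
theorem not_three_dvd_of_triGraph_adj {x y : Site 2} (h : triGraph.Adj x y) (hx : (3 : ℤ) ∣ x 0 - x 1) :
    ¬ (3 : ℤ) ∣ y 0 - y 1 := by
  rw [Mesh.triGraph_adj_iff_coord'] at h
  rcases h with h | h | h | h | h | h <;> omega

/-! ### The attachment `φ` -/

variable {φ : HexVertex → Site 2}
  (hφ : ∀ v : HexVertex, φ v = ![2 * v.1 0 + v.1 1 + ((v.2.val : ℕ) : ℤ) + 1, v.1 1 - v.1 0])
include hφ

/-- First coordinate of the site attached to an up face `(x, 0)`. [folklore] -/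
theorem hexSite_up_zero (x : Site 2) : φ (x, 0) 0 = 2 * x 0 + x 1 + 1 := by
  rw [hφ]; simp

/-- Second coordinate of the site attached to an up face `(x, 0)`. [folklore] -/
theorem hexSite_up_one (x : Site 2) : φ (x, 0) 1 = x 1 - x 0 := by
  rw [hφ]; simp

/-- First coordinate of the site attached to a down face `(x, 1)`. [folklore] -/
theorem hexSite_down_zero (x : Site 2) : φ (x, 1) 0 = 2 * x 0 + x 1 + 2 := by
  rw [hφ]; simp; ring

/-- Second coordinate of the site attached to a down face `(x, 1)`. [folklore] -/
theorem hexSite_down_one (x : Site 2) : φ (x, 1) 1 = x 1 - x 0 := by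
  rw [hφ]; simp

/-- **Attached sites are not centre sites**: `3 ∤ φ(v)₀ - φ(v)₁` (the residue is `t + 1`).
[folklore] -/
theorem not_three_dvd_hexSite (v : HexVertex) : ¬ (3 : ℤ) ∣ φ v 0 - φ v 1 := by
  rcases hexVertex_eq_up_or_down v with h | h <;> rw [h]
  · rw [hexSite_up_zero hφ, hexSite_up_one hφ]; omega
  · rw [hexSite_down_zero hφ, hexSite_down_one hφ]; omega

/-- **The attachment is injective.** [folklore] -/
theorem hexSite_injective : Function.Injective φ := by
  intro v w h
  have h0 := congrFun h 0
  have h1 := congrFun h 1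
  rcases hexVertex_eq_up_or_down v with hv | hv <;> rcases hexVertex_eq_up_or_down w with hw | hw <;>
    rw [hv, hw] at h0 h1 ⊢
  · rw [hexSite_up_zero hφ, hexSite_up_zero hφ] at h0
    rw [hexSite_up_one hφ, hexSite_up_one hφ] at h1
    exact Prod.ext (Mesh.site2_ext' (by dsimp only; omega) (by dsimp only; omega)) rfl
  · rw [hexSite_up_zero hφ, hexSite_down_zero hφ] at h0
    rw [hexSite_up_one hφ, hexSite_down_one hφ] at h1
    exfalso; omega
  · rw [hexSite_down_zero hφ, hexSite_up_zero hφ] at h0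
    rw [hexSite_down_one hφ, hexSite_up_one hφ] at h1
    exfalso; omega
  · rw [hexSite_down_zero hφ, hexSite_down_zero hφ] at h0
    rw [hexSite_down_one hφ, hexSite_down_one hφ] at h1
    exact Prod.ext (Mesh.site2_ext' (by dsimp only; omega) (by dsimp only; omega)) rfl

/-- **Every non-centre site is attached to a face.** [folklore] -/
theorem exists_hexSite_eq {x : Site 2} (hx : ¬ (3 : ℤ) ∣ x 0 - x 1) : ∃ v : HexVertex, φ v = x := by
  have hr : (x 0 - x 1) % 3 = 1 ∨ (x 0 - x 1) % 3 = 2 := by omega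
  rcases hr with hr | hr
  · -- type `t = 0`: `x₀ - x₁ = 3a + 1`
    refine ⟨(![(x 0 - x 1 - 1) / 3, x 1 + (x 0 - x 1 - 1) / 3], 0), Mesh.site2_ext' ?_ ?_⟩
    · rw [hexSite_up_zero hφ]
      simp only [Matrix.cons_val_zero, Matrix.cons_val_one]
      omega
    · rw [hexSite_up_one hφ]
      simp only [Matrix.cons_val_zero, Matrix.cons_val_one]
      omega
  · -- type `t = 1`: `x₀ - x₁ = 3a + 2`
    refine ⟨(![(x 0 - x 1 - 2) / 3, x 1 + (x 0 - x 1 - 2) / 3], 1), Mesh.site2_ext' ?_ ?_⟩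
    · rw [hexSite_down_zero hφ]
      simp only [Matrix.cons_val_zero, Matrix.cons_val_one]
      omega
    · rw [hexSite_down_one hφ]
      simp only [Matrix.cons_val_zero, Matrix.cons_val_one]
      omega

/-- The six `𝕋`-neighbours of a centre site are attached sites. [folklore] -/
theorem exists_hexSite_eq_of_adj_centre {s y : Site 2} (hs : (3 : ℤ) ∣ s 0 - s 1) (h : triGraph.Adj s y) :
    ∃ w : HexVertex, φ w = y :=
  exists_hexSite_eq hφ (not_three_dvd_of_triGraph_adj h hs)

/-! ### The embedding: `hexCenter = R · triEmbed ∘ φ` -/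

/-- **The honeycomb vertices are the non-centre sites of the fine triangular lattice**:
`hexCenter (x, t) = ((1 + ζ)/3) · triEmbed (φ(x, t))`. [folklore] -/
theorem hexCenter_eq (v : HexVertex) : hexCenter v = (1 + triZeta) / 3 * triEmbed (φ v) := by
  have hsq := triZeta_sq
  rw [hφ]
  simp only [hexCenter, triEmbed, Matrix.cons_val_zero, Matrix.cons_val_one]
  push_cast
  linear_combination (-(1 / 3 : ℂ) * ((v.1 1 : ℂ) - (v.1 0 : ℂ))) * hsq

/-- Scaled form: `δ · hexCenter v = ((1 + ζ)/3) · triMeshPoint δ (φ v)`. [folklore] -/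
theorem smul_hexCenter_eq (δ : ℝ) (v : HexVertex) :
    (δ : ℂ) * hexCenter v = (1 + triZeta) / 3 * triMeshPoint δ (φ v) := by
  rw [hexCenter_eq hφ]; unfold triMeshPoint; ring

/-! ### Adjacency -/

/-- **Honeycomb edges are edges of the fine triangular lattice.** [folklore] -/
theorem triGraph_adj_hexSite {v w : HexVertex} (h : hexGraph.Adj v w) : triGraph.Adj (φ v) (φ w) := by
  rw [Mesh.triGraph_adj_iff_coord']
  rcases hexVertex_eq_up_or_down v with hv | hv <;> rcases hexVertex_eq_up_or_down w with hw | hw <;>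
    rw [hv, hw] at h ⊢
  · exact absurd h (not_hexGraph_adj_of_snd_eq_holds _ _ rfl)
  · rw [hexSite_up_zero hφ, hexSite_up_one hφ, hexSite_down_zero hφ, hexSite_down_one hφ]
    rcases (hexGraph_adj_iff_of_snd_eq_zero_holds v.1 w.1).1 h with hx | hx | hx <;> rw [hx]
    · exact Or.inl ⟨by ring, rfl⟩
    · refine Or.inr (Or.inr (Or.inr (Or.inr (Or.inr ⟨?_, ?_⟩)))) <;> simp <;> ring
    · refine Or.inr (Or.inr (Or.inr (Or.inl ⟨?_, ?_⟩))) <;> simp <;> ring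
  · rw [hexSite_up_zero hφ, hexSite_up_one hφ, hexSite_down_zero hφ, hexSite_down_one hφ]
    rcases (hexGraph_adj_iff_of_snd_eq_one v.1 w.1).1 h with hx | hx | hx <;> rw [hx]
    · exact Or.inr (Or.inl ⟨by ring, rfl⟩)
    · refine Or.inr (Or.inr (Or.inr (Or.inr (Or.inl ⟨?_, ?_⟩)))) <;> simp <;> ring
    · refine Or.inr (Or.inr (Or.inl ⟨?_, ?_⟩)) <;> simp <;> ring
  · exact absurd h (not_hexGraph_adj_of_snd_eq_holds _ _ rfl)

/-- **Edges of the fine triangular lattice between attached sites are honeycomb edges**: a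
`𝕋`-neighbour of `φ v` that is not a centre site is `φ w` for a honeycomb neighbour `w` of `v`.
[folklore] -/
theorem exists_adj_of_triGraph_adj {v : HexVertex} {y : Site 2} (h : triGraph.Adj (φ v) y)
    (hy : ¬ (3 : ℤ) ∣ y 0 - y 1) : ∃ w : HexVertex, φ w = y ∧ hexGraph.Adj v w := by
  rw [Mesh.triGraph_adj_iff_coord'] at h
  rcases hexVertex_eq_up_or_down v with hv | hv <;> rw [hv] at h ⊢
  · rw [hexSite_up_zero hφ, hexSite_up_one hφ] at h
    -- the three down faces `(x, 1)`, `(x - e₀, 1)`, `(x - e₁, 1)`; the other three neighbours are centres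
    rcases h with h | h | h | h | h | h
    · refine ⟨(v.1, 1), Mesh.site2_ext' ?_ ?_, (hexGraph_adj_iff_of_snd_eq_zero_holds v.1 v.1).2 (Or.inl rfl)⟩
      · rw [hexSite_down_zero hφ]; omega
      · rw [hexSite_down_one hφ]; omega
    · exfalso; apply hy; omega
    · exfalso; apply hy; omega
    · refine ⟨(v.1 - Pi.single 1 1, 1), Mesh.site2_ext' ?_ ?_,
        (hexGraph_adj_iff_of_snd_eq_zero_holds v.1 _).2 (Or.inr (Or.inr rfl))⟩
      · rw [hexSite_down_zero hφ]; simp; omega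
      · rw [hexSite_down_one hφ]; simp; omega
    · exfalso; apply hy; omega
    · refine ⟨(v.1 - Pi.single 0 1, 1), Mesh.site2_ext' ?_ ?_,
        (hexGraph_adj_iff_of_snd_eq_zero_holds v.1 _).2 (Or.inr (Or.inl rfl))⟩
      · rw [hexSite_down_zero hφ]; simp; omega
      · rw [hexSite_down_one hφ]; simp; omega
  · rw [hexSite_down_zero hφ, hexSite_down_one hφ] at h
    -- the three up faces `(x, 0)`, `(x + e₀, 0)`, `(x + e₁, 0)`
    rcases h with h | h | h | h | h | h
    · exfalso; apply hy; omega
    · refine ⟨(v.1, 0), Mesh.site2_ext' ?_ ?_, (hexGraph_adj_iff_of_snd_eq_one v.1 v.1).2 (Or.inl rfl)⟩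
      · rw [hexSite_up_zero hφ]; omega
      · rw [hexSite_up_one hφ]; omega
    · refine ⟨(v.1 + Pi.single 1 1, 0), Mesh.site2_ext' ?_ ?_,
        (hexGraph_adj_iff_of_snd_eq_one v.1 _).2 (Or.inr (Or.inr rfl))⟩
      · rw [hexSite_up_zero hφ]; simp; omega
      · rw [hexSite_up_one hφ]; simp; omega
    · exfalso; apply hy; omega
    · refine ⟨(v.1 + Pi.single 0 1, 0), Mesh.site2_ext' ?_ ?_,
        (hexGraph_adj_iff_of_snd_eq_one v.1 _).2 (Or.inr (Or.inl rfl))⟩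
      · rw [hexSite_up_zero hφ]; simp; omega
      · rw [hexSite_up_one hφ]; simp; omega
    · exfalso; apply hy; omega

end Literature.Probability.LatticeModels.HexMesh
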